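import Literature.MathematicalPhysics.QuantumFieldTheory.Balaban1983to89.B9SectBGReadY

/-!
# `Balaban1983to89.B9SectBH1GReadWriteY` — THE (3.43) BOND-SECTOR READING OF AN OPERATOR `T` IN THE LETTERS OF `U` (Thm 3.3's `G`, Thm 3.4's `G(U′U)`):
# the pair-probe functional of def-Y's covariant bond quotient `holderQB`, the reading `h1ReadB`, and its READ ∕ WRITE dictionary
# (pub-ymgap N06 row 13, G side: the (3.43) member of `B9SectBCodedReadingsU.KACU` ∕ `SectBStepU`)

T. Bałaban, *Propagators for lattice gauge theories in a background field*, Commun. Math. Phys. **99** (1985) 389–434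
[`Balaban1985BackgroundPropagators`, "B9"]; [4] = T. Bałaban, *Propagators and renormalization transformations for lattice gauge
theories. II*, Commun. Math. Phys. **96** (1984) 223–250 [`Balaban1984PropagatorsII`].

statement-level skeleton of published theorems with citation tags; proofs where landed; nothing here is a claim about the
Yang–Mills mass gap

THE PRINTED LOCI.  (3.40) p. 397 (the covariant Hölder quotient `|U(Γ_{x,x′})A(x′) − A(x)| ∕ |x − x′|^α` of a bond function, pairs `|x − x′| ≦ 1` on the
`ξ`-lattice); (3.43) p. 398 read for Thm 3.3's `G` (p. 399: *"the same inequalities"*): `‖ζ∇_U G(U)λ‖_α, ‖ζG(U)∇*_Uλ‖_α ≦ B₀(α)(Lʲη)^{1−α}(‖ζ‖_α + |ζ|)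
e^{−δ₀d(y,y′)}|λ|`; (3.39) p. 397 (`|λ| ≦ 1`); Theorem 3.4 p. 400 and p. 403 l. 1–9 (the same bounds for `G(U′U)` in the norms OF `U`); [4] (2.137) p. 247 (the
admissible pairs), (2.51)–(2.52) p. 232.

WHY THIS FILE (seat dag-n06-c gen 14; the bond-sector (3.43) member of row 13 under R13-U1).  Gen 11's `B9SectBH1ReadWriteY` is the READ ∕ WRITE dictionary of
the SITE-sector Hölder reading (`hqS`, `h1ReadT`); def-Y's BOND-sector reading `Node00.OpsYULetters.kernelFamilyBU….h1` (the (3.43) member of the coded bond family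
`B9SectBCodedReadingsU.KACU`) reads `⨆_{‖E‖≤1} max (⨆_ν holderQB (par U) α ζ (∇_{U,ν}(T(J ⊗ E)))) (⨆_ν holderQB (par U) α ζ (T(∇*_{U,ν}(J ⊗ E))))` with def-Y's
covariant BOND quotient `holderQB` (a `⨆` over the ADMISSIBLE ordered pairs `(x, x′)` of the weighted transported differences
`(|x − x′|η)^{−α}‖ζ(x)Ψ(x) − R(U(Γ_{x,x′}))(ζ(x′)Ψ(x′))‖`).  THIS FILE is the bond twin of the site dictionary, the first brick of the transfer field
`B9SectBH1GFrameV5.H1GFrame₅.h1G_transfer` at NODE 00's letters: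
* §1 `wB` (the pair weight — the same quantity as dag-n06-d's `B9CoReadingCoordsHolder.wK`, restated to keep this module's import closure inside the Sect.-B
  chain), ★ `probeB par α ζ x x′` — THE PAIR-PROBE FUNCTIONAL `X ↦ (|x−x′|η)^{−α}·(ζ(x)X(x) − R(par x x′)(ζ(x′)X(x′)))` (ℝ-linear; the `Φ` of r06's per-probe Hölder
  transfers for the bond sector), `norm_probeB_le_holderQB` (admissible pairs), `holderQB_le_of_probeB`;
* §2 ★ `h1ReadB i T par U J α ζ` — THE (3.43) BOND READING OF A FIXED OPERATOR `T` IN THE LETTERS OF `U`, and the `rfl` bridges `kernelFamilyBU_h1_inr_eq` ∕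
  `KACU_h1_inr_eq` (def-Y's member IS this reading at `T := O (cfgW U′)`, `par := par (cfgU U′)`, `U := cfgU U′`);
* §3 the uniform bound over the unit ball by basis decomposition (`holderQB_liftY_le_sum`, `bddAbove_…`), §4 READ (`holderQBL∕R_le_h1ReadB`, `probeL∕R_le_h1ReadB`),
  §5 WRITE (`h1ReadB_le_of_probes`), §6 general `𝔸`-valued inputs `Σ_j J_j ⊗ b_j` (`probeL∕R_sum_le_of_h1ReadB`).
HONEST SCOPE.  Definitions and elementary bookkeeping (linearity, finite sums, `⨆` intro∕elim) over def-Y's readers; nothing of [B9] asserted; COUNT-NEUTRAL;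
N06 NOT discharged; one finite lattice programme at fixed ε — nothing continuum, nothing about OS positivity or the mass gap.  No `sorry`, no `axiom`, no
`instance`, no `notation`.  Cell `pub-ymgap` (HUMAN RULING D-0062), Track A node N06 [B9] row 13, seat `pub-ymgap-dag-n06-c` (g14), 2026-08-28;
`--supports stmt-QuantumFields-27364`.

RELATED IN THE TREE, NOT DUPLICATED: `B9SectBH1ReadWriteY` (site twin, gen 11), `Node00.OpsYHolderFar` (`holderQB_nonneg`, `pair_le_holderQB`,
`holderQB_le_of_forall_adm` — USED), `B9CoReadingCoordsHolder` (dag-n06-d: the coordinate-model probes of `holderQB` for the W-letter certificate; a different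
carrier and probe index, not importable here without its co-reading chain), `Node00.OpsYULetters` (`kernelFamilyBU_h1_inr` — USED), `B9SectBCodedReadingsU.KACU`.
-/

noncomputable section

namespace Literature.MathematicalPhysics.QuantumFieldTheory.Balaban1983to89.B9SectBH1GReadWriteY

open LatticeFieldCalculus (supDist)
open B9Eq39Adjoint (R R_smul R_zero R_sub R_add)
open B6GlobalChartV1 (PV)
open B6KLevelCensusIndexV1 (KIdx Adm)
open B9CoReadingCoords (cdBₗ cdsBₗ cdBₗ_apply cdsBₗ_apply)
open B9PinMembersKLevelV1 (MemberY geo9Y)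
open B9Eq360DeltaPrimeAY (AfldY)
open B9SectBGpFrameCodedY (codingYx)
open B9SectBGpReadingsY (baseY)
open B9SectBGpLettersY (decY)
open B9SectBCodedReadingsU (KACU)
open Node00 (FBondY CfgY BallY BondOpY BondParY liftY liftY_apply holderQB cdB cdsB iSup_ball_le)
open Node00.OpsYHolderFar (holderQB_nonneg pair_le_holderQB holderQB_le_of_forall_adm)
open Node00.OpsYRead342 (liftY_eq_sum_repr liftY_smul_right)
open Node00.OpsYULetters (kernelFamilyBU kernelFamilyBU_h1_inr)
open B9Thm314WholeExpansionReads (le_iSup_ball_max)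

variable {d ℓ : ℕ} {hd : 1 ≤ d + 1} {hL : Odd (ℓ + 1) ∧ 1 < ℓ + 1} {b₀ b₁ : ℝ}
variable {𝔸 : Type} [NormedRing 𝔸] [NormedAlgebra ℂ 𝔸] [CompleteSpace 𝔸]
variable (i : KIdx d ℓ hd hL b₀ b₁)

/-! ## §1 The pair weight, the pair-probe functional -/

/-- the pair weight of (3.40) in print's units: `(|x − x′|_∞·η)^{−α}`, `η = |c_f|⁻¹` — the weight INSIDE def-Y's `holderQB` (the same quantity as dag-n06-d's
`B9CoReadingCoordsHolder.wK`). [cite: Balaban1985BackgroundPropagators, (3.40) p.397] -/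
def wB (α : ℝ) (x x' : FBondY i) : ℝ := ((((supDist x.src x'.src : ℕ) : ℝ)) * |i.cf|⁻¹) ^ (-α)

omit [NormedRing 𝔸] [NormedAlgebra ℂ 𝔸] [CompleteSpace 𝔸] in
/-- `0 ≤ wB`. [cite: Balaban1985BackgroundPropagators, (3.40) p.397, bookkeeping] -/
theorem wB_nonneg (α : ℝ) (x x' : FBondY i) : 0 ≤ wB i α x x' := Real.rpow_nonneg (by positivity) _

omit [NormedRing 𝔸] [NormedAlgebra ℂ 𝔸] [CompleteSpace 𝔸] in
/-- the pair weight is symmetric. [cite: Balaban1985BackgroundPropagators, (3.40) p.397, bookkeeping] -/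
theorem wB_comm (α : ℝ) (x x' : FBondY i) : wB i α x x' = wB i α x' x := by
  unfold wB; rw [B3TorusRadialSums.supDist_comm]

/-- ★ **THE PAIR-PROBE FUNCTIONAL OF THE BOND SECTOR** at the ordered pair `(x, x′)`, cut-off `ζ`, exponent `α`, transporter `par`:
`X ↦ (|x−x′|η)^{−α}·(ζ(x)X(x) − R(par x x′)(ζ(x′)X(x′)))` — a REAL-linear functional of the `𝔸`-valued bond function `X` (the `Φ` of r06's per-probe Hölder transfers
`B9SectBH1GFrameV5.H1GFrame₅.h1G_transfer`, bond sector); its norm is the pair term of def-Y's `holderQB`. [cite: Balaban1985BackgroundPropagators, (3.40) p.397, (3.43) p.398] -/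
def probeB (par : Site (PV d ℓ i.m i.K hd hL) 0 → Site (PV d ℓ i.m i.K hd hL) 0 → 𝔸ˣ) (α : ℝ) (ζ : FBondY i → ℝ) (x x' : FBondY i) :
    (FBondY i → 𝔸) →ₗ[ℝ] 𝔸 where
  toFun X := wB i α x x' • ((((ζ x : ℝ) : ℂ)) • X x - R (par x.src x'.src) ((((ζ x' : ℝ) : ℂ)) • X x'))
  map_add' X Y := by
    simp only [Pi.add_apply, smul_add, R_add, add_sub_add_comm]
  map_smul' r X := by
    simp only [Pi.smul_apply, RingHom.id_apply]
    rw [smul_comm (((ζ x' : ℝ) : ℂ)) r (X x'), smul_comm (((ζ x : ℝ) : ℂ)) r (X x), R_smul, ← smul_sub, smul_comm r (wB i α x x')]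

omit [CompleteSpace 𝔸] in
/-- `probeB` applied. [cite: Balaban1985BackgroundPropagators, (3.40) p.397, bookkeeping] -/
theorem probeB_apply (par : Site (PV d ℓ i.m i.K hd hL) 0 → Site (PV d ℓ i.m i.K hd hL) 0 → 𝔸ˣ) (α : ℝ) (ζ : FBondY i → ℝ) (x x' : FBondY i)
    (X : FBondY i → 𝔸) :
    probeB i par α ζ x x' X = wB i α x x' • ((((ζ x : ℝ) : ℂ)) • X x - R (par x.src x'.src) ((((ζ x' : ℝ) : ℂ)) • X x')) := rfl

omit [CompleteSpace 𝔸] in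
/-- ★ **THE NORM OF THE PROBE IS THE PAIR TERM OF `holderQB`**: `‖probeB X‖ = (|x−x′|η)^{−α}·‖ζ(x)X(x) − R(par x x′)(ζ(x′)X(x′))‖`.
[cite: Balaban1985BackgroundPropagators, (3.40) p.397, (3.43) p.398] -/
theorem norm_probeB (par : Site (PV d ℓ i.m i.K hd hL) 0 → Site (PV d ℓ i.m i.K hd hL) 0 → 𝔸ˣ) (α : ℝ) (ζ : FBondY i → ℝ) (x x' : FBondY i)
    (X : FBondY i → 𝔸) :
    ‖probeB i par α ζ x x' X‖ = wB i α x x' * ‖(((ζ x : ℝ) : ℂ)) • X x - R (par x.src x'.src) ((((ζ x' : ℝ) : ℂ)) • X x')‖ := by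
  rw [probeB_apply, norm_smul, Real.norm_eq_abs, abs_of_nonneg (wB_nonneg i α x x')]

omit [CompleteSpace 𝔸] in
/-- the probe is blind to the sign of the argument. [cite: Balaban1985BackgroundPropagators, (3.40) p.397, bookkeeping] -/
theorem norm_probeB_neg (par : Site (PV d ℓ i.m i.K hd hL) 0 → Site (PV d ℓ i.m i.K hd hL) 0 → 𝔸ˣ) (α : ℝ) (ζ : FBondY i → ℝ) (x x' : FBondY i)
    (X : FBondY i → 𝔸) : ‖probeB i par α ζ x x' (-X)‖ = ‖probeB i par α ζ x x' X‖ := by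
  rw [map_neg, norm_neg]

omit [CompleteSpace 𝔸] in
/-- the probe is `ℝ`-homogeneous in norm: `‖probe(c·X)‖ = |c|·‖probe X‖`. [cite: Balaban1985BackgroundPropagators, (3.40) p.397, bookkeeping] -/
theorem norm_probeB_smul (par : Site (PV d ℓ i.m i.K hd hL) 0 → Site (PV d ℓ i.m i.K hd hL) 0 → 𝔸ˣ) (α : ℝ) (ζ : FBondY i → ℝ) (x x' : FBondY i)
    (c : ℝ) (X : FBondY i → 𝔸) : ‖probeB i par α ζ x x' (c • X)‖ = |c| * ‖probeB i par α ζ x x' X‖ := by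
  rw [map_smul, norm_smul, Real.norm_eq_abs]

omit [CompleteSpace 𝔸] in
/-- the probe is subadditive in norm over finite sums. [cite: Balaban1985BackgroundPropagators, (3.40) p.397, bookkeeping] -/
theorem norm_probeB_sum_le {κ : Type} (s : Finset κ) (par : Site (PV d ℓ i.m i.K hd hL) 0 → Site (PV d ℓ i.m i.K hd hL) 0 → 𝔸ˣ) (α : ℝ)
    (ζ : FBondY i → ℝ) (x x' : FBondY i) (X : κ → FBondY i → 𝔸) :
    ‖probeB i par α ζ x x' (∑ j ∈ s, X j)‖ ≤ ∑ j ∈ s, ‖probeB i par α ζ x x' (X j)‖ := by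
  rw [map_sum]; exact norm_sum_le _ _

omit [CompleteSpace 𝔸] in
/-- ★ **every ADMISSIBLE pair probe is below def-Y's bond quotient**: `‖probeB X‖ ≤ holderQB par α ζ X` on `Adm` pairs.
[cite: Balaban1985BackgroundPropagators, (3.40) p.397; Balaban1984PropagatorsII, (2.137) p.247] -/
theorem norm_probeB_le_holderQB (par : Site (PV d ℓ i.m i.K hd hL) 0 → Site (PV d ℓ i.m i.K hd hL) 0 → 𝔸ˣ) (α : ℝ) (ζ : FBondY i → ℝ)
    (X : FBondY i → 𝔸) {x x' : FBondY i} (hadm : Adm i x x') : ‖probeB i par α ζ x x' X‖ ≤ holderQB i par α ζ X := by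
  rw [norm_probeB]; exact pair_le_holderQB i par α ζ X hadm

omit [CompleteSpace 𝔸] in
/-- ★ **intro rule**: a bound `B ≥ 0` on every admissible pair probe bounds `holderQB`. [cite: Balaban1985BackgroundPropagators, (3.40) p.397; Balaban1984PropagatorsII, (2.137) p.247] -/
theorem holderQB_le_of_probeB (par : Site (PV d ℓ i.m i.K hd hL) 0 → Site (PV d ℓ i.m i.K hd hL) 0 → 𝔸ˣ) (α : ℝ) (ζ : FBondY i → ℝ)
    (X : FBondY i → 𝔸) {B : ℝ} (hB : 0 ≤ B) (h : ∀ x x' : FBondY i, Adm i x x' → ‖probeB i par α ζ x x' X‖ ≤ B) :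
    holderQB i par α ζ X ≤ B :=
  holderQB_le_of_forall_adm i par α ζ X hB fun x x' hadm => by
    have h1 := h x x' hadm
    rw [norm_probeB] at h1
    exact h1

omit [CompleteSpace 𝔸] in
/-- `holderQB` is blind to the sign of the argument. [cite: Balaban1985BackgroundPropagators, (3.40) p.397, bookkeeping] -/
theorem holderQB_neg (par : Site (PV d ℓ i.m i.K hd hL) 0 → Site (PV d ℓ i.m i.K hd hL) 0 → 𝔸ˣ) (α : ℝ) (ζ : FBondY i → ℝ)
    (X : FBondY i → 𝔸) : holderQB i par α ζ (-X) = holderQB i par α ζ X := by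
  refine le_antisymm ?_ ?_
  · exact holderQB_le_of_probeB i par α ζ _ (holderQB_nonneg i par α ζ X) fun x x' hadm => by
      rw [norm_probeB_neg]; exact norm_probeB_le_holderQB i par α ζ X hadm
  · exact holderQB_le_of_probeB i par α ζ _ (holderQB_nonneg i par α ζ _) fun x x' hadm => by
      rw [← norm_probeB_neg]; exact norm_probeB_le_holderQB i par α ζ _ hadm

/-! ## §2 The (3.43) bond reading of a fixed operator in the letters of `U` -/

/-- ★ **THE (3.43) BOND READING OF A FIXED OPERATOR `T` IN THE LETTERS OF `U` WITH THE TRANSPORTER `par`**: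
`⨆_{‖E‖≤1} max (⨆_ν holderQB par α ζ (∇_{U,ν}(T(J ⊗ E)))) (⨆_ν holderQB par α ζ (T(∇*_{U,ν}(J ⊗ E))))` — def-Y's `kernelFamilyBU….h1` when `T = O (cfgW U′)`,
`par = par (cfgU U′)`, `U = cfgU U′` (the product-aware reading R13-U1 of Thm 3.4's `G(U′U)` in the norms of `U`).
[cite: Balaban1985BackgroundPropagators, (3.43) p.398 with Thm 3.3 p.399, (3.40) p.397, Thm 3.4 p.400, p.403 l.1–9] -/
def h1ReadB (T : (FBondY i → 𝔸) →ₗ[ℂ] (FBondY i → 𝔸)) (par : Site (PV d ℓ i.m i.K hd hL) 0 → Site (PV d ℓ i.m i.K hd hL) 0 → 𝔸ˣ) (U : CfgY 𝔸 i)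
    (J : FBondY i → ℝ) (α : ℝ) (ζ : FBondY i → ℝ) : ℝ :=
  ⨆ E : BallY 𝔸, max (⨆ ν : Fin (d + 1), holderQB i par α ζ (cdB i U ν (T (liftY J (E : 𝔸)))))
    (⨆ ν : Fin (d + 1), holderQB i par α ζ (T (cdsB i U ν (liftY J (E : 𝔸)))))

/-- ★ def-Y's bond-sector (3.43) member IS the reading of `O (cfgW U′)` with the transporter and letters of `cfgU U′` (`rfl`): every lemma of this file applies to
`kernelFamilyBU….h1` verbatim. [cite: Balaban1985BackgroundPropagators, (3.43) p.398, Thm 3.4 p.400, bookkeeping] -/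
theorem kernelFamilyBU_h1_inr_eq (B : B9.Backgrounds) (cfgU cfgW : B.Cfg → CfgY 𝔸 i) (O : BondOpY 𝔸 i) (par : BondParY 𝔸 i) (U' : B.Cfg)
    (J : FBondY i → ℝ) (α : ℝ) (z : FBondY i → ℝ) :
    (kernelFamilyBU i B cfgU cfgW O par).h1 U' (.inr J) α (.inr z) = h1ReadB i (O (cfgW U')) (par (cfgU U')) (cfgU U') J α z := rfl

/-- ★ the (3.43) member of the coded bond family `KACU` at a coded configuration `c`: the reading of `OA (dec c)` in the letters of `base c` (`rfl`).
[cite: Balaban1985BackgroundPropagators, (3.43) p.398, Thm 3.4 p.400, bookkeeping] -/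
theorem KACU_h1_inr_eq {Mstar : ℕ} (G : Subgroup 𝔸ˣ) (x : MemberY d ℓ hd hL b₀ b₁ Mstar) (OA : BondOpY 𝔸 x.toKIdx) (parB : BondParY 𝔸 x.toKIdx)
    (C37 C38 : ℝ → CfgY 𝔸 x.toKIdx → AfldY 𝔸 x.toKIdx → Prop) (c : (codingYx G x C37 C38).bg.Cfg) (J : FBondY x.toKIdx → ℝ) (α : ℝ)
    (z : FBondY x.toKIdx → ℝ) :
    (KACU G x OA parB C37 C38).h1 c (.inr J) α (.inr z) =
      h1ReadB x.toKIdx (OA (decY x.toKIdx c)) (parB (baseY x.toKIdx c)) (baseY x.toKIdx c) J α z := rfl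

/-- the (3.43) member of `KACU` vanishes OFF the (bond argument, bond cut-off) sector (`rfl` ×3). [cite: Balaban1985BackgroundPropagators, (3.43) p.398, bookkeeping] -/
theorem KACU_h1_off {Mstar : ℕ} (G : Subgroup 𝔸ˣ) (x : MemberY d ℓ hd hL b₀ b₁ Mstar) (OA : BondOpY 𝔸 x.toKIdx) (parB : BondParY 𝔸 x.toKIdx)
    (C37 C38 : ℝ → CfgY 𝔸 x.toKIdx → AfldY 𝔸 x.toKIdx → Prop) (c : (codingYx G x C37 C38).bg.Cfg) (α : ℝ) :
    (∀ (J : FBondY x.toKIdx → ℝ) (zs : Node00.SiteY x.toKIdx → ℝ), (KACU G x OA parB C37 C38).h1 c (.inr J) α (.inl zs) = 0) ∧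
    (∀ (f : Node00.SiteY x.toKIdx → ℝ) (ζ : (geo9Y x).Cut), (KACU G x OA parB C37 C38).h1 c (.inl f) α ζ = 0) := by
  refine ⟨fun J zs => rfl, fun f ζ => ?_⟩
  rcases ζ with z | z <;> rfl

/-- `0 ≤ h1ReadB`. [cite: Balaban1985BackgroundPropagators, (3.43) p.398, bookkeeping] -/
theorem h1ReadB_nonneg (T : (FBondY i → 𝔸) →ₗ[ℂ] (FBondY i → 𝔸)) (par : Site (PV d ℓ i.m i.K hd hL) 0 → Site (PV d ℓ i.m i.K hd hL) 0 → 𝔸ˣ)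
    (U : CfgY 𝔸 i) (J : FBondY i → ℝ) (α : ℝ) (ζ : FBondY i → ℝ) : 0 ≤ h1ReadB i T par U J α ζ :=
  Real.iSup_nonneg fun _ => le_max_of_le_left (Real.iSup_nonneg fun _ => holderQB_nonneg i par α ζ _)

/-! ## §3 The uniform bound over the unit ball (the `BddAbove` of the reader's `⨆_E`) -/

section Ball

variable {ι : Type} [Fintype ι] (b : Module.Basis ι ℝ 𝔸) (par : Site (PV d ℓ i.m i.K hd hL) 0 → Site (PV d ℓ i.m i.K hd hL) 0 → 𝔸ˣ)

omit [CompleteSpace 𝔸] in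
/-- a real-linear word at `J ⊗ E`, decomposed along the basis: `W(J ⊗ E) = Σ_j repr_j(E)·W(J ⊗ b_j)`. [cite: Balaban1985BackgroundPropagators, (3.39) p.397, bookkeeping] -/
theorem word_liftY_eq_sum (W : (FBondY i → 𝔸) →ₗ[ℝ] (FBondY i → 𝔸)) (J : FBondY i → ℝ) (E : 𝔸) :
    W (liftY J E) = ∑ j, b.repr E j • W (liftY J (b j)) := by
  rw [liftY_eq_sum_repr b J E, map_sum]
  exact Finset.sum_congr rfl fun j _ => map_smul W _ _

omit [CompleteSpace 𝔸] in
/-- ★ the probe of a word at a direction `E` against the basis probes: `‖probe(W(J ⊗ E))‖ ≤ M₂‖E‖·Σ_j ‖probe(W(J ⊗ b_j))‖` under `|repr_j v| ≤ M₂‖v‖`.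
[cite: Balaban1985BackgroundPropagators, (3.40) p.397 + (3.39) p.397, bookkeeping] -/
theorem norm_probeB_liftY_le (W : (FBondY i → 𝔸) →ₗ[ℝ] (FBondY i → 𝔸)) (α : ℝ) (ζ : FBondY i → ℝ) (x x' : FBondY i)
    {M₂ : ℝ} (hrepr : ∀ (v : 𝔸) (j : ι), |b.repr v j| ≤ M₂ * ‖v‖) (J : FBondY i → ℝ) (E : 𝔸) :
    ‖probeB i par α ζ x x' (W (liftY J E))‖ ≤ M₂ * ‖E‖ * ∑ j, ‖probeB i par α ζ x x' (W (liftY J (b j)))‖ := by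
  rw [word_liftY_eq_sum i b, Finset.mul_sum]
  refine (norm_probeB_sum_le i _ par α ζ x x' _).trans (Finset.sum_le_sum fun j _ => ?_)
  rw [norm_probeB_smul]
  exact mul_le_mul_of_nonneg_right (hrepr E j) (norm_nonneg _)

omit [CompleteSpace 𝔸] in
/-- ★ a UNIFORM bound of `holderQB` of a word over the unit ball: `holderQB(W(J ⊗ E)) ≤ M₂·Σ_j holderQB(W(J ⊗ b_j))` for `‖E‖ ≤ 1`.
[cite: Balaban1985BackgroundPropagators, (3.43) p.398 (sup over |λ| ≤ 1), (3.40) p.397, bookkeeping] -/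
theorem holderQB_liftY_le_sum (W : (FBondY i → 𝔸) →ₗ[ℝ] (FBondY i → 𝔸)) (α : ℝ) (ζ : FBondY i → ℝ)
    {M₂ : ℝ} (hM₂ : 0 ≤ M₂) (hrepr : ∀ (v : 𝔸) (j : ι), |b.repr v j| ≤ M₂ * ‖v‖) (J : FBondY i → ℝ) {E : 𝔸} (hE : ‖E‖ ≤ 1) :
    holderQB i par α ζ (W (liftY J E)) ≤ M₂ * ∑ j, holderQB i par α ζ (W (liftY J (b j))) := by
  have hS : 0 ≤ ∑ j, holderQB i par α ζ (W (liftY J (b j))) := Finset.sum_nonneg fun j _ => holderQB_nonneg i par α ζ _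
  refine holderQB_le_of_probeB i par α ζ _ (mul_nonneg hM₂ hS) fun x x' hadm => ?_
  refine (norm_probeB_liftY_le i b par W α ζ x x' hrepr J E).trans ?_
  calc M₂ * ‖E‖ * ∑ j, ‖probeB i par α ζ x x' (W (liftY J (b j)))‖
      ≤ M₂ * 1 * ∑ j, holderQB i par α ζ (W (liftY J (b j))) := by
        refine mul_le_mul (mul_le_mul_of_nonneg_left hE hM₂) (Finset.sum_le_sum fun j _ => norm_probeB_le_holderQB i par α ζ _ hadm)
          (Finset.sum_nonneg fun j _ => norm_nonneg _) (mul_nonneg hM₂ zero_le_one)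
    _ = M₂ * ∑ j, holderQB i par α ζ (W (liftY J (b j))) := by rw [mul_one]

variable (T : (FBondY i → 𝔸) →ₗ[ℂ] (FBondY i → 𝔸)) (U : CfgY 𝔸 i)

/-- the LEFT word `∇_{U,ν} ∘ T` as a real-linear map, applied. [cite: Balaban1985BackgroundPropagators, (3.43) p.398 (first word), bookkeeping] -/
theorem wordL_apply (ν : Fin (d + 1)) (Λ : FBondY i → 𝔸) : (cdBₗ i U ν ∘ₗ T.restrictScalars ℝ) Λ = cdB i U ν (T Λ) := rfl

/-- the RIGHT word `T ∘ ∇*_{U,ν}` as a real-linear map, applied. [cite: Balaban1985BackgroundPropagators, (3.43) p.398 (second word), bookkeeping] -/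
theorem wordR_apply (ν : Fin (d + 1)) (Λ : FBondY i → 𝔸) : (T.restrictScalars ℝ ∘ₗ cdsBₗ i U ν) Λ = T (cdsB i U ν Λ) := rfl

/-- the uniform bounds of the two families of the reader over the unit ball. [cite: Balaban1985BackgroundPropagators, (3.43) p.398, bookkeeping] -/
theorem exists_bound_ball {M₂ : ℝ} (hM₂ : 0 ≤ M₂) (hrepr : ∀ (v : 𝔸) (j : ι), |b.repr v j| ≤ M₂ * ‖v‖) (J : FBondY i → ℝ) (α : ℝ) (ζ : FBondY i → ℝ) :
    (∀ ν : Fin (d + 1), ∃ C : ℝ, ∀ E : BallY 𝔸, holderQB i par α ζ (cdB i U ν (T (liftY J (E : 𝔸)))) ≤ C) ∧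
    (∀ ν : Fin (d + 1), ∃ C : ℝ, ∀ E : BallY 𝔸, holderQB i par α ζ (T (cdsB i U ν (liftY J (E : 𝔸)))) ≤ C) := by
  refine ⟨fun ν => ⟨M₂ * ∑ j, holderQB i par α ζ (cdB i U ν (T (liftY J (b j)))), fun E => ?_⟩,
    fun ν => ⟨M₂ * ∑ j, holderQB i par α ζ (T (cdsB i U ν (liftY J (b j)))), fun E => ?_⟩⟩
  · exact holderQB_liftY_le_sum i b par (cdBₗ i U ν ∘ₗ T.restrictScalars ℝ) α ζ hM₂ hrepr J (mem_closedBall_zero_iff.1 E.2)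
  · exact holderQB_liftY_le_sum i b par (T.restrictScalars ℝ ∘ₗ cdsBₗ i U ν) α ζ hM₂ hrepr J (mem_closedBall_zero_iff.1 E.2)

/-! ## §4 READ: every word at a unit-ball direction, and every admissible pair probe of it, is below the reading -/

/-- ★ **READ, LEFT WORDS**: `holderQB par α ζ (∇_{U,ν}T(J ⊗ E)) ≤ h1ReadB T par U J α ζ` for `‖E‖ ≤ 1`.
[cite: Balaban1985BackgroundPropagators, (3.43) p.398 (first word), Thm 3.3 p.399] -/
theorem holderQBL_le_h1ReadB {M₂ : ℝ} (hM₂ : 0 ≤ M₂) (hrepr : ∀ (v : 𝔸) (j : ι), |b.repr v j| ≤ M₂ * ‖v‖) (J : FBondY i → ℝ) (α : ℝ)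
    (ζ : FBondY i → ℝ) (E : BallY 𝔸) (ν : Fin (d + 1)) :
    holderQB i par α ζ (cdB i U ν (T (liftY J (E : 𝔸)))) ≤ h1ReadB i T par U J α ζ := by
  obtain ⟨hA, hA'⟩ := exists_bound_ball i b par T U hM₂ hrepr J α ζ
  unfold h1ReadB
  exact (le_iSup_ball_max hA hA' E ν).1

/-- ★ **READ, RIGHT WORDS**: `holderQB par α ζ (T∇*_{U,ν}(J ⊗ E)) ≤ h1ReadB T par U J α ζ` for `‖E‖ ≤ 1`.
[cite: Balaban1985BackgroundPropagators, (3.43) p.398 (second word), Thm 3.3 p.399] -/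
theorem holderQBR_le_h1ReadB {M₂ : ℝ} (hM₂ : 0 ≤ M₂) (hrepr : ∀ (v : 𝔸) (j : ι), |b.repr v j| ≤ M₂ * ‖v‖) (J : FBondY i → ℝ) (α : ℝ)
    (ζ : FBondY i → ℝ) (E : BallY 𝔸) (ν : Fin (d + 1)) :
    holderQB i par α ζ (T (cdsB i U ν (liftY J (E : 𝔸)))) ≤ h1ReadB i T par U J α ζ := by
  obtain ⟨hA, hA'⟩ := exists_bound_ball i b par T U hM₂ hrepr J α ζ
  unfold h1ReadB
  exact (le_iSup_ball_max hA hA' E ν).2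

/-- ★ **READ, LEFT PAIR PROBES**: every admissible pair probe of `∇_{U,ν}T(J ⊗ E)` is below the reading.
[cite: Balaban1985BackgroundPropagators, (3.43) p.398, (3.40) p.397] -/
theorem probeL_le_h1ReadB {M₂ : ℝ} (hM₂ : 0 ≤ M₂) (hrepr : ∀ (v : 𝔸) (j : ι), |b.repr v j| ≤ M₂ * ‖v‖) (J : FBondY i → ℝ) (α : ℝ)
    (ζ : FBondY i → ℝ) (E : BallY 𝔸) (ν : Fin (d + 1)) {x x' : FBondY i} (hadm : Adm i x x') :
    ‖probeB i par α ζ x x' (cdB i U ν (T (liftY J (E : 𝔸))))‖ ≤ h1ReadB i T par U J α ζ :=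
  (norm_probeB_le_holderQB i par α ζ _ hadm).trans (holderQBL_le_h1ReadB i b par T U hM₂ hrepr J α ζ E ν)

/-- ★ **READ, RIGHT PAIR PROBES**: every admissible pair probe of `T∇*_{U,ν}(J ⊗ E)` is below the reading.
[cite: Balaban1985BackgroundPropagators, (3.43) p.398, (3.40) p.397] -/
theorem probeR_le_h1ReadB {M₂ : ℝ} (hM₂ : 0 ≤ M₂) (hrepr : ∀ (v : 𝔸) (j : ι), |b.repr v j| ≤ M₂ * ‖v‖) (J : FBondY i → ℝ) (α : ℝ)
    (ζ : FBondY i → ℝ) (E : BallY 𝔸) (ν : Fin (d + 1)) {x x' : FBondY i} (hadm : Adm i x x') :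
    ‖probeB i par α ζ x x' (T (cdsB i U ν (liftY J (E : 𝔸))))‖ ≤ h1ReadB i T par U J α ζ :=
  (norm_probeB_le_holderQB i par α ζ _ hadm).trans (holderQBR_le_h1ReadB i b par T U hM₂ hrepr J α ζ E ν)

end Ball

/-! ## §5 WRITE: a common bound on all admissible pair probes bounds the reading -/

/-- ★★ **WRITE**: if `B ≥ 0` bounds every ADMISSIBLE pair probe of every left word `∇_{U,ν}T(J ⊗ E)` and every right word `T∇*_{U,ν}(J ⊗ E)`, `‖E‖ ≤ 1`, then
`h1ReadB T par U J α ζ ≤ B`. [cite: Balaban1985BackgroundPropagators, (3.43) p.398, (3.40) p.397; Balaban1984PropagatorsII, (2.137) p.247] -/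
theorem h1ReadB_le_of_probes (T : (FBondY i → 𝔸) →ₗ[ℂ] (FBondY i → 𝔸)) (par : Site (PV d ℓ i.m i.K hd hL) 0 → Site (PV d ℓ i.m i.K hd hL) 0 → 𝔸ˣ)
    (U : CfgY 𝔸 i) (J : FBondY i → ℝ) (α : ℝ) (ζ : FBondY i → ℝ) {B : ℝ} (hB : 0 ≤ B)
    (hL : ∀ (E : BallY 𝔸) (ν : Fin (d + 1)) (x x' : FBondY i), Adm i x x' → ‖probeB i par α ζ x x' (cdB i U ν (T (liftY J (E : 𝔸))))‖ ≤ B)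
    (hR : ∀ (E : BallY 𝔸) (ν : Fin (d + 1)) (x x' : FBondY i), Adm i x x' → ‖probeB i par α ζ x x' (T (cdsB i U ν (liftY J (E : 𝔸))))‖ ≤ B) :
    h1ReadB i T par U J α ζ ≤ B :=
  iSup_ball_le (fun E => max_le (Real.iSup_le (fun ν => holderQB_le_of_probeB i par α ζ _ hB fun x x' h => hL E ν x x' h) hB)
    (Real.iSup_le (fun ν => holderQB_le_of_probeB i par α ζ _ hB fun x x' h => hR E ν x x' h) hB)) hB

/-! ## §6 General `𝔸`-valued inputs: `Σ_j J_j ⊗ b_j` -/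

section General

variable {ι : Type} [Fintype ι] (b : Module.Basis ι ℝ 𝔸) (T : (FBondY i → 𝔸) →ₗ[ℂ] (FBondY i → 𝔸))
  (par : Site (PV d ℓ i.m i.K hd hL) 0 → Site (PV d ℓ i.m i.K hd hL) 0 → 𝔸ˣ) (U : CfgY 𝔸 i)

omit [CompleteSpace 𝔸] in
/-- `f ⊗ v = ‖v‖·(f ⊗ v̂)` with `v̂ = ‖v‖⁻¹v` (`v ≠ 0`), any carrier. [cite: Balaban1985BackgroundPropagators, (3.39) p.397, bookkeeping] -/
theorem liftY_eq_norm_smul_unit' {X : Type} (f : X → ℝ) {v : 𝔸} (hv : v ≠ 0) : liftY (X := X) f v = ‖v‖ • liftY f (‖v‖⁻¹ • v) := by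
  have hn : ‖v‖ ≠ 0 := norm_ne_zero_iff.2 hv
  funext w
  rw [Pi.smul_apply, liftY_apply, liftY_apply, smul_comm ((f w : ℝ) : ℂ) (‖v‖⁻¹) v, ← mul_smul, mul_inv_cancel₀ hn, one_smul]

omit [CompleteSpace 𝔸] in
/-- the normalised vector is in the unit ball (the `|λ| ≦ 1` normalisation of (3.39)). [cite: Balaban1985BackgroundPropagators, (3.39) p.397, bookkeeping] -/
theorem norm_inv_norm_smul_le_one (v : 𝔸) : ‖(‖v‖⁻¹ • v : 𝔸)‖ ≤ 1 := by
  by_cases hv : v = 0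
  · simp [hv]
  · rw [norm_smul, norm_inv, norm_norm, inv_mul_cancel₀ (norm_ne_zero_iff.2 hv)]

/-- the normalised vector as a point of the unit ball of (3.39). [cite: Balaban1985BackgroundPropagators, (3.39) p.397, bookkeeping] -/
def unitBall (v : 𝔸) : BallY 𝔸 := ⟨‖v‖⁻¹ • v, mem_closedBall_zero_iff.2 (norm_inv_norm_smul_le_one v)⟩

omit [CompleteSpace 𝔸] in
/-- `liftY` is additive in the scalar function, any carrier. [cite: Balaban1985BackgroundPropagators, (3.39) p.397, bookkeeping] -/
theorem liftY_finset_sum' {X S : Type} (s : Finset S) (h : S → X → ℝ) (E : 𝔸) : liftY (∑ a ∈ s, h a) E = ∑ a ∈ s, liftY (h a) E := by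
  classical
  induction s using Finset.induction_on with
  | empty => funext x; simp [liftY_apply]
  | insert a s ha ih =>
    rw [Finset.sum_insert ha, Finset.sum_insert ha, ← ih]
    funext x
    simp only [liftY_apply, Pi.add_apply, Complex.ofReal_add, add_smul]

/-- ★★ **GENERAL INPUTS, LEFT WORDS**: the admissible pair probe of the left word `∇_{U,ν}T(Σ_j J_j ⊗ b_j)` is at most `Σ_j ‖b_j‖·B_j` under reading bounds
`h1ReadB T par U J_j α ζ ≤ B_j` (basis vectors normalised into the unit ball). [cite: Balaban1985BackgroundPropagators, (3.43) p.398, (3.39)–(3.40) p.397; Balaban1984PropagatorsII, (2.51)–(2.52) p.232] -/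
theorem probeL_sum_le_of_h1ReadB {M₂ : ℝ} (hM₂ : 0 ≤ M₂) (hrepr : ∀ (v : 𝔸) (j : ι), |b.repr v j| ≤ M₂ * ‖v‖) (α : ℝ) (ζ : FBondY i → ℝ)
    (Jj : ι → FBondY i → ℝ) (Bj : ι → ℝ) (hB : ∀ j, h1ReadB i T par U (Jj j) α ζ ≤ Bj j) (ν : Fin (d + 1)) {x x' : FBondY i} (hadm : Adm i x x') :
    ‖probeB i par α ζ x x' (cdB i U ν (T (∑ j, liftY (Jj j) (b j))))‖ ≤ ∑ j, ‖b j‖ * Bj j := by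
  have hw : cdB i U ν (T (∑ j, liftY (Jj j) (b j))) = ∑ j, cdB i U ν (T (liftY (Jj j) (b j))) := by
    rw [← wordL_apply, map_sum]; rfl
  rw [hw]
  refine (norm_probeB_sum_le i _ par α ζ x x' _).trans (Finset.sum_le_sum fun j _ => ?_)
  have hbj : b j ≠ 0 := b.ne_zero j
  rw [liftY_eq_norm_smul_unit' (Jj j) hbj, ← wordL_apply, map_smul, wordL_apply, norm_probeB_smul, abs_norm]
  refine mul_le_mul_of_nonneg_left ?_ (norm_nonneg _)
  exact (probeL_le_h1ReadB i b par T U hM₂ hrepr (Jj j) α ζ (unitBall (b j)) ν hadm).trans (hB j)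

/-- ★★ **GENERAL INPUTS, RIGHT WORDS.** [cite: Balaban1985BackgroundPropagators, (3.43) p.398, (3.39)–(3.40) p.397; Balaban1984PropagatorsII, (2.51)–(2.52) p.232] -/
theorem probeR_sum_le_of_h1ReadB {M₂ : ℝ} (hM₂ : 0 ≤ M₂) (hrepr : ∀ (v : 𝔸) (j : ι), |b.repr v j| ≤ M₂ * ‖v‖) (α : ℝ) (ζ : FBondY i → ℝ)
    (Jj : ι → FBondY i → ℝ) (Bj : ι → ℝ) (hB : ∀ j, h1ReadB i T par U (Jj j) α ζ ≤ Bj j) (ν : Fin (d + 1)) {x x' : FBondY i} (hadm : Adm i x x') :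
    ‖probeB i par α ζ x x' (T (cdsB i U ν (∑ j, liftY (Jj j) (b j))))‖ ≤ ∑ j, ‖b j‖ * Bj j := by
  have hw : T (cdsB i U ν (∑ j, liftY (Jj j) (b j))) = ∑ j, T (cdsB i U ν (liftY (Jj j) (b j))) := by
    rw [← wordR_apply, map_sum]; rfl
  rw [hw]
  refine (norm_probeB_sum_le i _ par α ζ x x' _).trans (Finset.sum_le_sum fun j _ => ?_)
  have hbj : b j ≠ 0 := b.ne_zero j
  rw [liftY_eq_norm_smul_unit' (Jj j) hbj, ← wordR_apply, map_smul, wordR_apply, norm_probeB_smul, abs_norm]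
  refine mul_le_mul_of_nonneg_left ?_ (norm_nonneg _)
  exact (probeR_le_h1ReadB i b par T U hM₂ hrepr (Jj j) α ζ (unitBall (b j)) ν hadm).trans (hB j)

end General

end Literature.MathematicalPhysics.QuantumFieldTheory.Balaban1983to89.B9SectBH1GReadWriteY

end
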